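import Summits.HodgeConjecture.CorCM.CyclicSexticFaceMonomialAlgebraic
import Summits.HodgeConjecture.CorCM.Model.WeilFaceAlgebraicOfWeilLineClasses
import Summits.HodgeConjecture.CorCM.Model.CMAbelianVarietyRealisedHolds
import Summits.HodgeConjecture.CorCM.Model.CMSliceOfWeilFaces
import Summits.HodgeConjecture.CorCM.Geometry.BallQuotientUniformisedHolds
import Literature.AlgebraicGeometry.HodgeTheory.AbelianVarietyHodgeFullnessHolds
import HarnessLib

/-!
# COR-CM (cell `pub-hodgecm2`), A1 line — the rung: `W^{RK4}` at degree `6` and the Hodge conjecture for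
# products of CM abelian varieties of a Galois SEXTIC CM field, GIVEN MARKMAN'S FOURFOLD THEOREM ONLY

HONEST FRAMING (cell pub-hodgecm2 / COR-CM, seat b30 gen 11; COUNT-NEUTRAL — no binder row of
`HOME/BINDER-OWNERS.md`; the conclusions are CONDITIONAL on the displayed named fact
`HodgeTheory.Markman2025_weilClasses_algebraic_abelianFourfold` (B2b floor R1: the Weil classes of abelian fourfolds
of Weil type are algebraic); the model's records `hHD hI hU h₃` are parameters of the model universe as everywhere in
the cell — `hHD`, `hI`, `h₃` are now theorems of the tree (`exists_isReal_hodgeModel_holds`,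
`hodgePQ_independent_of_hodgeModel_holds`, `Model.cmAbelianVarietyRealised_holds`), `hU` is the Picard-surface
uniformisation datum through which the model universe is built).  Riemann's theorem `hR` (row B02) is DISCHARGED
here by the tree's theorem `deligneMilne1982_Thm_6_20_full_holds`.

Composition of this seat's T1 (`CyclicSextic.weilLineClasses_corner_le_algebraicClasses_of_markman`, file
`CyclicSexticFaceMonomialAlgebraic.lean`: FINDING F-6 of `HOME/pub-hodgecm2-lit-andre-3/PORTFOLIO-lit-andre-3.md`)
with seat b07's model junction T3/T4 (`Model.weilFaceAlgebraic_of_weilLineClasses_le`,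
`Model.hc_cmProd_of_weilFaceAlgebraic_of_riemann`, `Model.hodgeConjectureFor_of_avDominatedBy_cmProdAV_of_weilLineClasses_of_riemann`):

* `universeOf_weilFaceAlgebraic_sextic_of_markman` — `U.WeilFaceAlgebraic K f` for `U := Model.universeOf hHD hI hU h₃`,
  every Galois CM field `K` of degree `6` and every rank-four face `f` (the degree-`6` slice of `U.W_RK4`);
* `universeOf_hc_cmProd_sextic_of_markman` — `U.HC (U.cmProd K Θ)` for every family `Θ` of CM types of such `K`
  (the conclusion of `U.FaceReduction`, every codimension);
* `hodgeConjectureFor_cmProdAV_sextic_of_markman`, `hodgeConjectureFor_of_avDominatedBy_cmProdAV_sextic_of_markman` —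
  the same read on the tree's abelian varieties: the Hodge conjecture for `∏_j A_{(K,Θ_j)}` and for every complex
  abelian variety dominated by such a product, conditional on Markman's theorem;
* `hodgeConjectureFor_of_avDominatedBy_isProductOf_sextic_of_markman`,
  `hodgeConjectureFor_of_avDominatedBy_powSucc_prod_powSucc_sextic_of_markman` — the CLOSED forms over seat b24's
  `CorCM/Model/CMSliceOfWeilFaces.lean` (`hHD hI h₃ hR` := the tree's theorems, `hU := ballQuotientUniformisedDatum_of h₁`):
  HC for every abelian variety dominated by a finite product of CM abelian varieties realising CM types of CM subfields
  of the Galois sextic field `K` — headline `B^{a+1} × E^{b+1}` (A1′ CONSEQUENCE 2 of lit-andre-3's portfolio: NEW IN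
  PRINT for the cyclic sextic CM fields not covered by Shioda–Aoki, PORTFOLIO-g2 §4.2), displayed leaves
  {Markman's fourfold theorem, `h₁ : BallQuotientUniformised`}.

THEOREMS ONLY; no `sorry`; axioms `propext`, `Classical.choice`, `Quot.sound`.

## References
* [Markman2025SurveySecant] E. Markman, arXiv:2509.23403, Thm. 1.2 (the displayed hypothesis).
* [Andre1992HodgeCM] Y. André, Progr. Math. 102 (1992), Théorème and p. 2.
* [Pohlmann1968] H. Pohlmann, Ann. Math. 88 (1968), Thm. 1.
* [DeligneMilne1982Tannakian] P. Deligne, J. S. Milne, LNM 900 (1982), Thm. 6.20 (Riemann) — now a theorem of the tree.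
-/

noncomputable section

namespace Summit.HodgeConjecture.CorCM.CyclicSextic

open NumberField
open Literature.AlgebraicGeometry.Motives Literature.AlgebraicGeometry.HodgeTheory
open Literature.NumberTheory.Automorphic.PicardCM

variable (hHD : exists_isReal_hodgeModel) (hI : hodgePQ_independent_of_hodgeModel)
variable (hU : BallQuotientUniformisedDatum) (h₃ : CMAbelianVarietyRealised)

/-- **`W_K(P(f))` is algebraic on the model of record for every face of a Galois sextic CM field, given Markman's
fourfold theorem** (Riemann's theorem discharged by `deligneMilne1982_Thm_6_20_full_holds`).
[cite: Markman2025SurveySecant, Thm. 1.2] [cite: Andre1992HodgeCM, p. 2] -/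
theorem universeOf_weilFaceAlgebraic_sextic_of_markman (hW4 : Markman2025_weilClasses_algebraic_abelianFourfold)
    (K : CMField) [IsGalois ℚ K] (h6 : Module.finrank ℚ K = 6) (f : Face K) :
    (Model.universeOf hHD hI hU h₃).WeilFaceAlgebraic K f :=
  Model.weilFaceAlgebraic_of_weilLineClasses_le hHD hI hU h₃ K f
    (weilLineClasses_corner_le_algebraicClasses_of_markman hW4 deligneMilne1982_Thm_6_20_full_holds h₃ h6 f
      fun j => Model.cornerAV_isCMTypeRealisation h₃ K f.corner j)

/-- **`HC(∏_j A_{(K,Θ_j)})` on the model of record, in every codimension, for every Galois sextic CM field `K`,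
given Markman's fourfold theorem** (face reduction `Model.hc_cmProd_of_weilFaceAlgebraic_of_riemann`, Riemann
discharged). [cite: Markman2025SurveySecant, Thm. 1.2] [cite: Pohlmann1968, Thm. 1] [cite: Andre1992HodgeCM, Théorème (pp. 4–5)] -/
theorem universeOf_hc_cmProd_sextic_of_markman (hW4 : Markman2025_weilClasses_algebraic_abelianFourfold)
    (K : CMField) [hG : IsGalois ℚ K] (h6 : Module.finrank ℚ K = 6) {n : ℕ} (Θ : Fin (n + 1) → CMType K) :
    (Model.universeOf hHD hI hU h₃).HC ((Model.universeOf hHD hI hU h₃).cmProd K Θ) :=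
  Model.hc_cmProd_of_weilFaceAlgebraic_of_riemann hHD hI hU h₃ K deligneMilne1982_Thm_6_20_full_holds hG
    (le_of_eq h6.symm) (fun f => universeOf_weilFaceAlgebraic_sextic_of_markman hHD hI hU h₃ hW4 K h6 f) Θ

include hHD hI hU in
/-- **The Hodge conjecture for the abelian variety `∏_j A_{(K,Θ_j)}`** (`Domination.cmProdAV K h₃ n Θ`, the chosen
realisations of CM types `Θ_j` of a Galois sextic CM field `K`), given Markman's fourfold theorem; relative to the
model records `hHD hI hU` through which seat b07's junction reads the face reduction.
[cite: Markman2025SurveySecant, Thm. 1.2] [cite: Andre1992HodgeCM, Théorème (pp. 4–5)] -/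
theorem hodgeConjectureFor_cmProdAV_sextic_of_markman (hW4 : Markman2025_weilClasses_algebraic_abelianFourfold)
    (K : CMField) [hG : IsGalois ℚ K] (h6 : Module.finrank ℚ K = 6) {n : ℕ} (Θ : Fin (n + 1) → CMType K) :
    HodgeConjectureFor (Domination.cmProdAV K h₃ n Θ).dim (Domination.cmProdAV K h₃ n Θ).X :=
  Model.hodgeConjectureFor_cmProdAV_of_weilLineClasses_of_riemann hHD hI hU h₃ K
    deligneMilne1982_Thm_6_20_full_holds hG (le_of_eq h6.symm)
    (fun f => mem_algebraicClasses_of_mem_weilLineClasses_corner_of_markman hW4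
      deligneMilne1982_Thm_6_20_full_holds h₃ h6 f fun j => Model.cornerAV_isCMTypeRealisation h₃ K f.corner j) Θ

include hHD hI hU in
/-- **… and for every complex abelian variety dominated by such a product** (`Domination.AVDominatedBy A (∏_j A_{(K,Θ_j)})`:
`s ≫ π = [N]_A`, `N ≠ 0` — every abelian variety isogenous to a product of powers of CM abelian varieties with CM types
of the Galois sextic field `K`), given Markman's fourfold theorem. [cite: Markman2025SurveySecant, Thm. 1.2]
[cite: Andre1992HodgeCM, Théorème (pp. 4–5)] -/
theorem hodgeConjectureFor_of_avDominatedBy_cmProdAV_sextic_of_markman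
    (hW4 : Markman2025_weilClasses_algebraic_abelianFourfold)
    (K : CMField) [hG : IsGalois ℚ K] (h6 : Module.finrank ℚ K = 6) (A : AbelianVariety ℂ) {n : ℕ}
    {Θ : Fin (n + 1) → CMType K} (hdom : Domination.AVDominatedBy A (Domination.cmProdAV K h₃ n Θ)) :
    HodgeConjectureFor A.dim A.X :=
  Model.hodgeConjectureFor_of_avDominatedBy_cmProdAV_of_weilLineClasses_of_riemann hHD hI hU h₃ K
    deligneMilne1982_Thm_6_20_full_holds hG (le_of_eq h6.symm)
    (fun f => mem_algebraicClasses_of_mem_weilLineClasses_corner_of_markman hW4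
      deligneMilne1982_Thm_6_20_full_holds h₃ h6 f fun j => Model.cornerAV_isCMTypeRealisation h₃ K f.corner j) A hdom

/-- **The records discharged**: the Hodge conjecture for every complex abelian variety dominated by a product of CM
abelian varieties of a Galois sextic CM field, with `hHD`, `hI`, `h₃` supplied by the tree's theorems
(`exists_isReal_hodgeModel_holds`, `hodgePQ_independent_of_hodgeModel_holds`, `Model.cmAbelianVarietyRealised_holds`);
only Markman's fourfold theorem and the Picard-surface uniformisation datum `hU` of the model remain as hypotheses.
[cite: Markman2025SurveySecant, Thm. 1.2] [cite: Andre1992HodgeCM, Théorème (pp. 4–5)] -/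
theorem hodgeConjectureFor_of_avDominatedBy_cmProdAV_sextic_of_markman'
    (hU : BallQuotientUniformisedDatum) (hW4 : Markman2025_weilClasses_algebraic_abelianFourfold)
    (K : CMField) [IsGalois ℚ K] (h6 : Module.finrank ℚ K = 6) (A : AbelianVariety ℂ) {n : ℕ}
    {Θ : Fin (n + 1) → CMType K}
    (hdom : Domination.AVDominatedBy A (Domination.cmProdAV K cmAbelianVarietyRealised_holds n Θ)) :
    HodgeConjectureFor A.dim A.X :=
  hodgeConjectureFor_of_avDominatedBy_cmProdAV_sextic_of_markman exists_isReal_hodgeModel_holds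
    hodgePQ_independent_of_hodgeModel_holds hU cmAbelianVarietyRealised_holds hW4 K h6 A hdom

/-- **Closed form (A1′ CONSEQUENCE 2 for a Galois sextic CM field): the Hodge conjecture for every complex abelian
variety dominated by a finite product of CM abelian varieties realising CM types of CM subfields of `K`, given Markman's
fourfold theorem** — displayed leaves: Markman's theorem and `h₁ : BallQuotientUniformised` (the model's Picard-surface
uniformisation record); `hHD hI h₃ hR` are the tree's theorems (seat b24's closed form
`hodgeConjectureFor_of_avDominatedBy_isProductOf_of_weilFaceAlgebraic` fed with `universeOf_weilFaceAlgebraic_sextic_of_markman`).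
[cite: Markman2025SurveySecant, Thm. 1.2] [cite: Andre1992HodgeCM, Théorème (pp. 4–5)] -/
theorem hodgeConjectureFor_of_avDominatedBy_isProductOf_sextic_of_markman
    (hW4 : Markman2025_weilClasses_algebraic_abelianFourfold) (K : CMField) (h₁ : BallQuotientUniformised)
    [hG : IsGalois ℚ K] (h6 : Module.finrank ℚ K = 6) {P A : AbelianVariety ℂ}
    (hP : AbelianVariety.IsProductOf (fun B : AbelianVariety ℂ =>
      ∃ (E : Type) (_ : Field E) (_ : NumberField E) (_ : IsCMField E) (_ : E →+* (K : Type)) (Φ : CMType E)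
        (ι : 𝓞 E →+* CategoryTheory.End B) (θ : E →+* Module.End ℂ (complexBetti B.X 1)),
        Literature.AlgebraicGeometry.ComplexMultiplication.IsCMTypeRealisation Φ B ι θ) P)
    (hA : Domination.AVDominatedBy A P) : HodgeConjectureFor A.dim A.X :=
  hodgeConjectureFor_of_avDominatedBy_isProductOf_of_weilFaceAlgebraic K h₁ hG (le_of_eq h6.symm)
    (fun f => universeOf_weilFaceAlgebraic_sextic_of_markman exists_isReal_hodgeModel_holds
      hodgePQ_independent_of_hodgeModel_holds (ballQuotientUniformisedDatum_of h₁) cmAbelianVarietyRealised_holds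
      hW4 K h6 f) hP hA

/-- **Headline `B^{a+1} × E^{b+1}`**: for a realisation `B` of a CM type of the Galois sextic CM field `K` and a
realisation `E` of a CM type of a CM field `E₀` embedded in `K` (e.g. a CM elliptic curve of the imaginary quadratic
subfield), the Hodge conjecture holds for every abelian variety dominated by `B^{a+1} × E^{b+1}`, given Markman's
fourfold theorem (and the model record `h₁`). [cite: Markman2025SurveySecant, Thm. 1.2] [cite: Andre1992HodgeCM, Théorème (pp. 4–5)] -/
theorem hodgeConjectureFor_of_avDominatedBy_powSucc_prod_powSucc_sextic_of_markman
    (hW4 : Markman2025_weilClasses_algebraic_abelianFourfold) (K : CMField) (h₁ : BallQuotientUniformised)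
    [hG : IsGalois ℚ K] (h6 : Module.finrank ℚ K = 6)
    {Ψ : CMType K} {B : AbelianVariety ℂ} {ιB : 𝓞 K →+* CategoryTheory.End B}
    {θB : (K : Type) →+* Module.End ℂ (complexBetti B.X 1)}
    (hB : Literature.AlgebraicGeometry.ComplexMultiplication.IsCMTypeRealisation Ψ B ιB θB)
    {E₀ : Type} [Field E₀] [NumberField E₀] [IsCMField E₀] (k : E₀ →+* (K : Type)) {Φ₀ : CMType E₀}
    {E : AbelianVariety ℂ} {ιE : 𝓞 E₀ →+* CategoryTheory.End E} {θE : E₀ →+* Module.End ℂ (complexBetti E.X 1)}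
    (hE : Literature.AlgebraicGeometry.ComplexMultiplication.IsCMTypeRealisation Φ₀ E ιE θE) (a b : ℕ)
    {A : AbelianVariety ℂ} (hA : Domination.AVDominatedBy A ((B.powSucc a).prod (E.powSucc b))) :
    HodgeConjectureFor A.dim A.X :=
  hodgeConjectureFor_of_avDominatedBy_powSucc_prod_powSucc_of_weilFaceAlgebraic K h₁ hG (le_of_eq h6.symm)
    (fun f => universeOf_weilFaceAlgebraic_sextic_of_markman exists_isReal_hodgeModel_holds
      hodgePQ_independent_of_hodgeModel_holds (ballQuotientUniformisedDatum_of h₁) cmAbelianVarietyRealised_holds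
      hW4 K h6 f) hB k hE a b hA

/-! ## v2 (seat b30 gen 12, 2026-08-21) — the model record `h₁` DISCHARGED: displayed leaf {Markman's fourfold theorem} ONLY

Seat b10's tree theorem `BallQuotient.ballQuotientUniformised_holds : PicardCM.BallQuotientUniformised`
(`CorCM/Geometry/BallQuotientUniformisedHolds.lean`: compact arithmetic ball quotients are smooth projective surfaces
uniformised by the ball — Shafarevich BAG 2 IX §3.2 / Kollár 1995 Thm. 5.22, proved in the tree) closes the last model
record of the closed forms above.  Every hypothesis of the four theorems below other than
`hW4 : Markman2025_weilClasses_algebraic_abelianFourfold` is data (`K`, the face / the family of types / the dominated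
variety); the "model universe of record" is the one of `Assembly/ModelChainClosed.lean`,
`Model.picardCMUniverse exists_isReal_hodgeModel_holds hodgePQ_independent_of_hodgeModel_holds
BallQuotient.ballQuotientUniformised_holds cmAbelianVarietyRealised_holds`
(`= Model.universeOf … (ballQuotientUniformisedDatum_of BallQuotient.ballQuotientUniformised_holds) …` by `rfl`). -/

/-- **The degree-`6` slice of `W^{RK4}` on the model universe OF RECORD, from Markman's fourfold theorem alone**:
`U.WeilFaceAlgebraic K f` for `U := Model.picardCMUniverse (tree theorems)`, every Galois sextic CM field `K` and every
rank-four face `f`. [cite: Markman2025SurveySecant, Thm. 1.2] [cite: Andre1992HodgeCM, p. 2] -/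
theorem picardCMUniverse_weilFaceAlgebraic_sextic_of_markman
    (hW4 : Markman2025_weilClasses_algebraic_abelianFourfold) (K : CMField) [IsGalois ℚ K]
    (h6 : Module.finrank ℚ K = 6) (f : Face K) :
    (Model.picardCMUniverse exists_isReal_hodgeModel_holds hodgePQ_independent_of_hodgeModel_holds
      BallQuotient.ballQuotientUniformised_holds cmAbelianVarietyRealised_holds).WeilFaceAlgebraic K f :=
  universeOf_weilFaceAlgebraic_sextic_of_markman exists_isReal_hodgeModel_holds
    hodgePQ_independent_of_hodgeModel_holds (ballQuotientUniformisedDatum_of BallQuotient.ballQuotientUniformised_holds)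
    cmAbelianVarietyRealised_holds hW4 K h6 f

/-- **`U.HC (U.cmProd K Θ)` on the model universe OF RECORD, every codimension, from Markman's fourfold theorem
alone** (the conclusion of `U.FaceReduction` at every Galois sextic CM field `K` and every family of CM types `Θ`).
[cite: Markman2025SurveySecant, Thm. 1.2] [cite: Pohlmann1968, Thm. 1] [cite: Andre1992HodgeCM, Théorème (pp. 4–5)] -/
theorem picardCMUniverse_hc_cmProd_sextic_of_markman
    (hW4 : Markman2025_weilClasses_algebraic_abelianFourfold) (K : CMField) [IsGalois ℚ K]
    (h6 : Module.finrank ℚ K = 6) {n : ℕ} (Θ : Fin (n + 1) → CMType K) :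
    (Model.picardCMUniverse exists_isReal_hodgeModel_holds hodgePQ_independent_of_hodgeModel_holds
      BallQuotient.ballQuotientUniformised_holds cmAbelianVarietyRealised_holds).HC
      ((Model.picardCMUniverse exists_isReal_hodgeModel_holds hodgePQ_independent_of_hodgeModel_holds
        BallQuotient.ballQuotientUniformised_holds cmAbelianVarietyRealised_holds).cmProd K Θ) :=
  universeOf_hc_cmProd_sextic_of_markman exists_isReal_hodgeModel_holds hodgePQ_independent_of_hodgeModel_holds
    (ballQuotientUniformisedDatum_of BallQuotient.ballQuotientUniformised_holds) cmAbelianVarietyRealised_holds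
    hW4 K h6 Θ

/-- **h₁-free closed form (A1′ CONSEQUENCE 2, Galois sextic CM field): the Hodge conjecture for every complex abelian
variety dominated by a finite product of CM abelian varieties realising CM types of CM subfields of `K`, GIVEN ONLY
Markman's fourfold theorem** — `hodgeConjectureFor_of_avDominatedBy_isProductOf_sextic_of_markman` at
`h₁ := BallQuotient.ballQuotientUniformised_holds`; no model record is displayed any more.
[cite: Markman2025SurveySecant, Thm. 1.2] [cite: Andre1992HodgeCM, Théorème (pp. 4–5)] -/
theorem hodgeConjectureFor_of_avDominatedBy_isProductOf_sextic_of_markman_closed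
    (hW4 : Markman2025_weilClasses_algebraic_abelianFourfold) (K : CMField) [IsGalois ℚ K]
    (h6 : Module.finrank ℚ K = 6) {P A : AbelianVariety ℂ}
    (hP : AbelianVariety.IsProductOf (fun B : AbelianVariety ℂ =>
      ∃ (E : Type) (_ : Field E) (_ : NumberField E) (_ : IsCMField E) (_ : E →+* (K : Type)) (Φ : CMType E)
        (ι : 𝓞 E →+* CategoryTheory.End B) (θ : E →+* Module.End ℂ (complexBetti B.X 1)),
        Literature.AlgebraicGeometry.ComplexMultiplication.IsCMTypeRealisation Φ B ι θ) P)
    (hA : Domination.AVDominatedBy A P) : HodgeConjectureFor A.dim A.X :=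
  hodgeConjectureFor_of_avDominatedBy_isProductOf_sextic_of_markman hW4 K
    BallQuotient.ballQuotientUniformised_holds h6 hP hA

/-- **Headline `B^{a+1} × E^{b+1}`, h₁-free**: for a realisation `B` of a CM type of the Galois sextic CM field `K`
and a realisation `E` of a CM type of a CM field `E₀` embedded in `K` (e.g. the CM elliptic curve of the imaginary
quadratic subfield), the Hodge conjecture holds for every complex abelian variety dominated by `B^{a+1} × E^{b+1}`,
GIVEN ONLY Markman's fourfold theorem (`Markman2025_weilClasses_algebraic_abelianFourfold`, the single displayed leaf).
[cite: Markman2025SurveySecant, Thm. 1.2] [cite: Andre1992HodgeCM, Théorème (pp. 4–5)] -/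
theorem hodgeConjectureFor_of_avDominatedBy_powSucc_prod_powSucc_sextic_of_markman_closed
    (hW4 : Markman2025_weilClasses_algebraic_abelianFourfold) (K : CMField) [IsGalois ℚ K]
    (h6 : Module.finrank ℚ K = 6)
    {Ψ : CMType K} {B : AbelianVariety ℂ} {ιB : 𝓞 K →+* CategoryTheory.End B}
    {θB : (K : Type) →+* Module.End ℂ (complexBetti B.X 1)}
    (hB : Literature.AlgebraicGeometry.ComplexMultiplication.IsCMTypeRealisation Ψ B ιB θB)
    {E₀ : Type} [Field E₀] [NumberField E₀] [IsCMField E₀] (k : E₀ →+* (K : Type)) {Φ₀ : CMType E₀}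
    {E : AbelianVariety ℂ} {ιE : 𝓞 E₀ →+* CategoryTheory.End E} {θE : E₀ →+* Module.End ℂ (complexBetti E.X 1)}
    (hE : Literature.AlgebraicGeometry.ComplexMultiplication.IsCMTypeRealisation Φ₀ E ιE θE) (a b : ℕ)
    {A : AbelianVariety ℂ} (hA : Domination.AVDominatedBy A ((B.powSucc a).prod (E.powSucc b))) :
    HodgeConjectureFor A.dim A.X :=
  hodgeConjectureFor_of_avDominatedBy_powSucc_prod_powSucc_sextic_of_markman hW4 K
    BallQuotient.ballQuotientUniformised_holds h6 hB k hE a b hA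

end Summit.HodgeConjecture.CorCM.CyclicSextic

end
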